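import Summits.QuantumAdvantage.QuantumAdvantage.Theses.ArithStatLadder
import Literature.Computability.Cryptography.HallgrenClassGroup
import Literature.Computability.Cryptography.ShorProofs
import Literature.Computability.QuantumComplexity.CWrapAssembly
import Literature.Computability.Complexity.BrickAlgebra
import Literature.Computability.Complexity.BranchingFn
import Literature.Computability.Complexity.StackBricksArith
import Literature.Computability.Complexity.ZIntBricks
import Summits.QuantumAdvantage.QuantumAdvantage.Theorems.IqThreeMemBQP.Negative.RefutationCost

/-!
# `IqThreeMemBQP` (stmt-QuantumAdvantage-2424) — the search-to-decision glue: bare binary prefixes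
# are ambiguous, self-delimited outputs are not

Negative-side / plumbing lemmas for the crux `ArithStatLadder.IqThreeMemBQP` (`IQ3 ∈ BQP`), extracted
from the refuter work file `Summits/QuantumAdvantage/QuantumAdvantage/Cruxes/IqThreeMemBQP/Disproof.lean`
(cdisprove cycle 2, §6). Sorry-free; axioms ⊆ {propext, Classical.choice, Quot.sound}; theorems only.

Context. The only near-term deliverable around the crux is the GRH-conditional support
`GrandRiemannHypothesisGL → IqThreeMemBQP`, which the route file, the grounder and cycle 1 of the
Disproof all describe as "`Hallgren2005_classNumber_qsolvable_of_GRH` ∘ decision-from-search". The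
vendored fact (`Literature/Computability/Cryptography/HallgrenClassGroup.lean`) asks the quantum family
to write `encodeNat (h(−d))` as a BARE PREFIX of the measured string. Mathlib's binary code
`encodeNat` is not prefix-free (`encodeNat 1 = [true] <+: [true, true] = encodeNat 3`,
`encodeNat_one_isPrefix_encodeNat_three`), and a candidate class number cannot be verified, so the
conclusion of the fact does not determine `h(−d)` — not even `3 ∣ h(−d)`:

* `iqThreeMemBQP_hallgrenFact_collapse` — by monotonicity of `IsQSolvable` in the relation
  (`IsQSolvable.mono`), the fact's conclusion for the TRUE class number implies the same conclusion for
  the WRONG function `h' = (if h = 3 then 1 else h)`; `iqThreeMemBQP_hallgrenFact_underdetermines_threeDvd`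
  packages this with the witness `d = 23` (`h(−23) = 3`, `h'(−23) = 1`): every witness family of the
  fact for `h` is also a witness for `h'`, and the two functions disagree on `3 ∣ ·` at a fundamental
  discriminant, so no post-processing that is uniform in the class-number function (in particular no
  "read `h` off the output and test `3 ∣ h`") can turn the fact AS TYPED into the decision corollary.
* The repair is the tree's own convention for composable search facts (cf.
  `Hallgren2007_regulator_qsolvable_delim` in `HallgrenPell.lean`, whose docstring records the same
  pitfall for the regulator): write the answer in the pair convention `y = boolPair (encodeNat h) w`.
  `iqThreeMemBQP_hallgrenFact_of_delim` — the self-delimited form implies the plain fact (so it is a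
  harmless strengthening for the fact's proof programme, whose read-out `clOrderEst` is exact anyway);
  `iqThreeMemBQP_threeDvdBit_qsolvable_of_delim` — and it DOES yield the quantum core of the decision
  corollary: the one-bit relation `x ↦ {z | IsNegFundamentalDiscr (decodeNat x) → [3 ∣ h(−d)] <+: z}`
  is `IsQSolvable`, by the PROVED `isQSolvable_classicalWrap_holds` with the `FP` post-processor
  `isNilFn ∘ remFn ∘ fanoutFn (fstF ∘ sndF) (const (bin 3))` (bricks of `StackBricksArith`,
  `BrickAlgebra`, `BranchingFn`). What then remains for `GRH → IqThreeMemBQP` is language-level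
  bookkeeping (fundamentality of `−d` via `isQSolvable_factoring_holds`, rejection of non-canonical
  words, `mem_BQP_of_isQSolvable_bit`), for which the guard `IsNegFundamentalDiscr` should ALSO be
  dropped from the fact (the Kitaev/Hallgren programme `HallgrenClassGroupQuantumKernel.lean` already
  treats every negative discriminant), see the Disproof work file §6–§7.
* `isQSolvable_guardedPrefix_mono` / `isQSolvable_guardedPrefix_mono_forall` — the generic form of the
  collapse, which applies verbatim to any stub of the shape "output `encodeNat (…)` as a prefix under a
  promise", e.g. the real-quadratic one-class-order primitive `RealQuadraticPrimeClassOrderQSolvable` of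
  the crux's idea card mirror-dodge (`Cruxes/IqThreeMemBQP/Ideator2Sketch.lean`), where a candidate
  order cannot be verified without a principal-ideal test: such stubs must be typed self-delimited
  (`boolPair`) or as the needed bit (`[3 ∣ ord]`).
-/

noncomputable section

namespace Summit.QuantumAdvantage.QuantumAdvantage.Theorems.IqThreeMemBQP.Negative

open _root_.Computability Literature.Computability.Complexity Literature.Computability.Complexity.Brick
open Literature.Computability.Cryptography Literature.NumberTheory.QuadraticFields
open Literature.NumberTheory.LFunctions

/-! ### Binary codes are not prefix-free -/

/-- `bin 1` is a prefix of `bin 3` although `3 ∤ 1` and `3 ∣ 3`: a bare `encodeNat` prefix does not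
determine `3`-divisibility of the encoded number. [folklore] -/
theorem encodeNat_one_isPrefix_encodeNat_three : encodeNat 1 <+: encodeNat 3 ∧ ¬ 3 ∣ 1 ∧ 3 ∣ 3 := by
  decide

/-! ### Monotonicity: guarded-prefix relations only see the answer up to prefix-collapse -/

/-- If `g x` is always a prefix of `f x`, a quantum solver for "under the promise `P x`, output `f x`
as a prefix" is also a solver for the same problem with `g` in place of `f` (`IsQSolvable.mono`).
[folklore] -/
theorem isQSolvable_guardedPrefix_mono {P : List Bool → Prop} {f g : List Bool → List Bool}
    (hfg : ∀ x, g x <+: f x) (h : IsQSolvable fun x => {y | P x → f x <+: y}) :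
    IsQSolvable fun x => {y | P x → g x <+: y} :=
  h.mono fun x _ hy hP => (hfg x).trans (hy hP)

/-- Indexed form of `isQSolvable_guardedPrefix_mono` (promises and answers ranging over a parameter,
the shape of `RealQuadraticPrimeClassOrderQSolvable`-type stubs). [folklore] -/
theorem isQSolvable_guardedPrefix_mono_forall {ι : Sort*} {P : List Bool → ι → Prop}
    {f g : List Bool → ι → List Bool} (hfg : ∀ x i, g x i <+: f x i)
    (h : IsQSolvable fun x => {y | ∀ i, P x i → f x i <+: y}) :
    IsQSolvable fun x => {y | ∀ i, P x i → g x i <+: y} :=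
  h.mono fun x _ hy i hP => (hfg x i).trans (hy i hP)

/-- The collapse `3 ↦ 1` shortens binary codes to a prefix. [folklore] -/
theorem encodeNat_collapse_isPrefix (n : ℕ) : encodeNat (if n = 3 then 1 else n) <+: encodeNat n := by
  split_ifs with h
  · subst h
    decide
  · exact List.prefix_rfl

/-- **The vendored Hallgren fact does not pin `3 ∣ h`.** Its conclusion for the true class number
implies the same conclusion for the wrong function `h' = (if h = 3 then 1 else h)`. [folklore] -/
theorem iqThreeMemBQP_hallgrenFact_collapse (hH : Hallgren2005_classNumber_qsolvable_of_GRH)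
    (hG : GrandRiemannHypothesisGL) :
    IsQSolvable fun x : List Bool =>
      {y | IsNegFundamentalDiscr (decodeNat x) →
        encodeNat (if BinaryQuadraticForm.classNumber (-(decodeNat x : ℤ)) = 3 then 1
          else BinaryQuadraticForm.classNumber (-(decodeNat x : ℤ))) <+: y} :=
  isQSolvable_guardedPrefix_mono (P := fun x => IsNegFundamentalDiscr (decodeNat x))
    (f := fun x => encodeNat (BinaryQuadraticForm.classNumber (-(decodeNat x : ℤ))))
    (g := fun x => encodeNat (if BinaryQuadraticForm.classNumber (-(decodeNat x : ℤ)) = 3 then 1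
      else BinaryQuadraticForm.classNumber (-(decodeNat x : ℤ))))
    (fun _ => encodeNat_collapse_isPrefix _) (hH hG)

/-- **Packaged**: there is a function `g ≠ h` on which the fact's conclusion also holds (given the
fact and GRH) but which gets `3`-divisibility wrong at the fundamental discriminant `−23`
(`h(−23) = 3`, `g(−23) = 1`). Hence the decision corollary `GRH → IQ3 ∈ BQP` is not a consequence of
the fact AS TYPED by any argument uniform in the class-number function. [folklore] -/
theorem iqThreeMemBQP_hallgrenFact_underdetermines_threeDvd :
    ∃ g : ℤ → ℕ,
      (Hallgren2005_classNumber_qsolvable_of_GRH → GrandRiemannHypothesisGL →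
        IsQSolvable fun x : List Bool =>
          {y | IsNegFundamentalDiscr (decodeNat x) → encodeNat (g (-(decodeNat x : ℤ))) <+: y}) ∧
      IsNegFundamentalDiscr 23 ∧ 3 ∣ BinaryQuadraticForm.classNumber (-23) ∧ ¬ 3 ∣ g (-23) := by
  refine ⟨fun D => if BinaryQuadraticForm.classNumber D = 3 then 1 else BinaryQuadraticForm.classNumber D,
    fun hH hG => iqThreeMemBQP_hallgrenFact_collapse hH hG, ?_, ?_, ?_⟩
  · left
    refine ⟨by decide, ?_, by decide⟩
    have h23 : Prime (-23 : ℤ) := Int.prime_iff_natAbs_prime.2 (by norm_num)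
    exact h23.squarefree
  · rw [classNumber_neg_twentythree]
  · simp only [classNumber_neg_twentythree, if_true]
    decide

/-! ### The repair: self-delimited output (the tree's `_delim` convention) -/

/-- **Self-delimited ⇒ plain.** If (under GRH) some family writes the class number in the pair
convention, `y = boolPair (encodeNat h(−d)) w`, then the vendored plain fact holds (post-process with
`fstF ∘ sndF ∈ FP` through the PROVED `isQSolvable_classicalWrap_holds`; same proof as
`Hallgren2007_regulator_qsolvable_of_delim`). So re-typing the fact self-delimited is a harmless
strengthening. [folklore] -/
theorem iqThreeMemBQP_hallgrenFact_of_delim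
    (hdelim : GrandRiemannHypothesisGL →
      IsQSolvable fun x : List Bool =>
        {y | IsNegFundamentalDiscr (decodeNat x) →
          ∃ w : List Bool,
            y = boolPair (encodeNat (BinaryQuadraticForm.classNumber (-(decodeNat x : ℤ)))) w}) :
    Hallgren2005_classNumber_qsolvable_of_GRH := by
  intro hG
  have hwrap := isQSolvable_classicalWrap_holds (fun x => x) (fstF ∘ sndF)
    (PolyTimeComputable.id _) (comp_mem_FP fstF_mem_FP sndF_mem_FP) (hdelim hG)
  refine hwrap.mono fun x z hz => ?_
  simp only [Set.mem_setOf_eq] at hz ⊢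
  obtain ⟨y, hy, hpre⟩ := hz
  intro hfund
  obtain ⟨w, rfl⟩ := hy hfund
  have hg : (fstF ∘ sndF) (boolPair x (boolPair
      (encodeNat (BinaryQuadraticForm.classNumber (-(decodeNat x : ℤ)))) w)) =
      encodeNat (BinaryQuadraticForm.classNumber (-(decodeNat x : ℤ))) := by
    simp [Function.comp]
  rw [hg] at hpre
  exact hpre

/-- The `FP` post-processor reading the bit `[3 ∣ m]` off `⟨x, boolPair (bin m) w⟩`:
`isNilFn ∘ remFn ∘ fanoutFn (fstF ∘ sndF) (const (bin 3))` is polynomial-time. [folklore] -/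
theorem threeDvdPost_mem_FP :
    (isNilFn ∘ remFn ∘ fanoutFn (fstF ∘ sndF) (fun _ => encodeNat 3)) ∈ FP :=
  comp_mem_FP isNilFn_mem_FP
    (comp_mem_FP remFn_mem_FP
      (fanoutFn_mem_FP (comp_mem_FP fstF_mem_FP sndF_mem_FP) (const_mem_FP _)))

/-- … and computes `[decide (3 ∣ m)]`. [folklore] -/
theorem threeDvdPost_apply (x w : List Bool) (m : ℕ) :
    (isNilFn ∘ remFn ∘ fanoutFn (fstF ∘ sndF) (fun _ => encodeNat 3))
      (boolPair x (boolPair (encodeNat m) w)) = [decide (3 ∣ m)] := by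
  simp only [Function.comp_apply, fanoutFn_apply, sndF_boolPair, fstF_boolPair, remFn_boolPair,
    bitsToNat_encodeNat, isNilFn, encodeNat_eq_nil_iff]
  simp only [Nat.dvd_iff_mod_eq_zero]

/-- **Self-delimited ⇒ the decision bit.** From the self-delimited form of the Hallgren fact, under
GRH the one-bit search problem "on a negative fundamental discriminant `−d`, write `[3 ∣ h(−d)]` on
wire `0`" is solvable in bounded-error quantum polynomial time (classical wrap with the post-processor
above). This is the quantum core of the conditional support `GRH → IqThreeMemBQP`; the rest is
language-level bookkeeping (fundamentality test, canonical words, `mem_BQP_of_isQSolvable_bit`).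
[folklore] -/
theorem iqThreeMemBQP_threeDvdBit_qsolvable_of_delim
    (hdelim : GrandRiemannHypothesisGL →
      IsQSolvable fun x : List Bool =>
        {y | IsNegFundamentalDiscr (decodeNat x) →
          ∃ w : List Bool,
            y = boolPair (encodeNat (BinaryQuadraticForm.classNumber (-(decodeNat x : ℤ)))) w})
    (hG : GrandRiemannHypothesisGL) :
    IsQSolvable fun x : List Bool =>
      {z | IsNegFundamentalDiscr (decodeNat x) →
        [decide (3 ∣ BinaryQuadraticForm.classNumber (-(decodeNat x : ℤ)))] <+: z} := by
  have hwrap := isQSolvable_classicalWrap_holds (fun x => x)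
    (isNilFn ∘ remFn ∘ fanoutFn (fstF ∘ sndF) (fun _ => encodeNat 3))
    (PolyTimeComputable.id _) threeDvdPost_mem_FP (hdelim hG)
  refine hwrap.mono fun x z hz => ?_
  simp only [Set.mem_setOf_eq] at hz ⊢
  obtain ⟨y, hy, hpre⟩ := hz
  intro hfund
  obtain ⟨w, rfl⟩ := hy hfund
  rwa [threeDvdPost_apply] at hpre

end Summit.QuantumAdvantage.QuantumAdvantage.Theorems.IqThreeMemBQP.Negative

end
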